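import Summits.CriticalPhenomena.CardyFormulaZ2.Theorems.CardyIKTransportIKMixedBoxCrossingQuenchedMixtureDefs

/-!
# Total mass of the quenched weights (line `defect-closure-exploration` v7 / ALT line `quenched-chain-fkg`,
# crux `IKMixedBoxCrossing`, stmt-CriticalPhenomena-5911)

Support file (`--supports stmt-CriticalPhenomena-5911`, registered helper stub `quenchedProb_powerset`), shared by the stubs
`stub_annealedQuenchedBound`, `stub_quenchedHarris`, `stub_quenchedMixture` of `…QuenchedMixtureDefs`: for `D ⊆ innerVertices Λ`
and an admissible pattern `v ∈ patterns D` the quenched weights `quenchedW D Λ v` form a PROBABILITY on `Λ.powerset` —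
`quenchedProb D Λ v Λ.powerset = 1` (`quenchedProb_powerset`) — and they are nonnegative (`quenchedW_nonneg`).
Ingredients (elementary, sorry-free): the component cell sets `comps D` are pairwise disjoint, lie in `Λ`, avoid the free cells
and together with the free cells cover `Λ` (§2); a sum over the subsets of a disjoint union factorises (§1); the three chain
weights of one component sum to `1/V + (V − 2)/V + 1/V = 1` (§3); the free cells carry the fair product weight.  No new definitions.
-/

noncomputable section

namespace Summit.CriticalPhenomena.CardyFormulaZ2.Cruxes.IKMixedBoxCrossing.QuenchedChainFKG

open scoped Classical BigOperators
open Finset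
open Literature.Probability.LatticeModels

namespace TotalMass

/-! ## §1 Sums over the subsets of a disjoint union -/

/-- Summing over the subsets of a disjoint union `P ∪ Q` is summing over pairs of subsets (folklore).
-- adapted from `Literature/Probability/LatticeModels/CurrentsAvoidMixing.lean` (`sum_powerset_union_of_disjoint`). -/
theorem sum_powerset_union_eq {α M : Type*} [DecidableEq α] [AddCommMonoid M] {P Q : Finset α} (h : Disjoint P Q)
    (f : Finset α → M) :
    ∑ s ∈ (P ∪ Q).powerset, f s = ∑ a ∈ P.powerset, ∑ b ∈ Q.powerset, f (a ∪ b) := by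
  rw [← Finset.sum_product' P.powerset Q.powerset fun a b => f (a ∪ b)]
  refine (Finset.sum_nbij' (M := M) (fun p => p.1 ∪ p.2) (fun s => (s ∩ P, s ∩ Q)) ?_ ?_ ?_ ?_ fun _ _ => rfl).symm
  · intro p hp
    rw [Finset.mem_product, Finset.mem_powerset, Finset.mem_powerset] at hp
    exact Finset.mem_powerset.2 (Finset.union_subset_union hp.1 hp.2)
  · intro s _
    rw [Finset.mem_product, Finset.mem_powerset, Finset.mem_powerset]
    exact ⟨Finset.inter_subset_right, Finset.inter_subset_right⟩
  · intro p hp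
    rw [Finset.mem_product, Finset.mem_powerset, Finset.mem_powerset] at hp
    have h1 : (p.1 ∪ p.2) ∩ P = p.1 := by
      rw [Finset.union_inter_distrib_right, Finset.inter_eq_left.2 hp.1,
        Finset.disjoint_iff_inter_eq_empty.1 (h.symm.mono_left hp.2), Finset.union_empty]
    have h2 : (p.1 ∪ p.2) ∩ Q = p.2 := by
      rw [Finset.union_inter_distrib_right, Finset.inter_eq_left.2 hp.2,
        Finset.disjoint_iff_inter_eq_empty.1 (h.mono_left hp.1), Finset.empty_union]
    rw [h1, h2]
  · intro s hs
    rw [Finset.mem_powerset] at hs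
    change s ∩ P ∪ s ∩ Q = s
    rw [← Finset.inter_union_distrib_left, Finset.inter_eq_left.2 hs]

/-- FACTORISATION over pairwise disjoint blocks: summing, over the subsets `s` of the union of the blocks `K ∈ B`, a product of
functions of the traces `s ∩ K` gives the product of the one-block sums. -/
theorem sum_powerset_biUnion_prod {α : Type*} [DecidableEq α] (B : Finset (Finset α))
    (hB : ∀ K ∈ B, ∀ K' ∈ B, K ≠ K' → Disjoint K K') (f : Finset α → Finset α → ℝ) :
    ∑ s ∈ (B.biUnion id).powerset, ∏ K ∈ B, f K (s ∩ K) = ∏ K ∈ B, ∑ τ ∈ K.powerset, f K τ := by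
  induction B using Finset.induction_on with
  | empty => simp
  | insert K B hKB ih =>
    have hd : Disjoint K (B.biUnion id) := by
      rw [Finset.disjoint_biUnion_right]
      intro K' hK'
      exact hB K (mem_insert_self _ _) K' (mem_insert_of_mem hK') fun h => hKB (h ▸ hK')
    have hB' : ∀ K ∈ B, ∀ K' ∈ B, K ≠ K' → Disjoint K K' := fun K hK K' hK' =>
      hB K (mem_insert_of_mem hK) K' (mem_insert_of_mem hK')
    rw [Finset.biUnion_insert, id, sum_powerset_union_eq hd, Finset.prod_insert hKB, ← ih hB', Finset.sum_mul_sum]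
    refine Finset.sum_congr rfl fun a ha => Finset.sum_congr rfl fun b hb => ?_
    rw [Finset.mem_powerset] at ha hb
    rw [Finset.prod_insert hKB]
    congr 1
    · rw [Finset.union_inter_distrib_right, Finset.inter_eq_left.2 ha,
        Finset.disjoint_iff_inter_eq_empty.1 (hd.symm.mono_left hb), Finset.union_empty]
    · refine Finset.prod_congr rfl fun K' hK' => ?_
      rw [Finset.union_inter_distrib_right, Finset.disjoint_iff_inter_eq_empty.1
        ((hB K (mem_insert_self _ _) K' (mem_insert_of_mem hK') fun h => hKB (h ▸ hK')).mono_left ha), Finset.empty_union]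

/-! ## §2 Components: reachability, disjointness, the partition of `Λ` -/

/-- Faces whose blocks share a cell are reachable from one another in the defect graph. -/
theorem reachable_of_mem_cellFace {D : Finset (Site 2)} (a b : {g // g ∈ D}) {x : Site 2}
    (ha : x ∈ cellFace a.1) (hb : x ∈ cellFace b.1) : (defectGraph D).Reachable a b := by
  by_cases hab : a = b
  · exact hab ▸ SimpleGraph.Reachable.refl a
  · exact SimpleGraph.Adj.reachable
      ((SimpleGraph.fromRel_adj _ a b).2 ⟨hab, Or.inl ⟨x, Finset.mem_inter.2 ⟨ha, hb⟩⟩⟩)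

/-- Membership in a component cell set. -/
theorem mem_compCells_iff {D : Finset (Site 2)} {g : {g // g ∈ D}} {x : Site 2} :
    x ∈ compCells D g ↔ ∃ g' : {g // g ∈ D}, (defectGraph D).Reachable g g' ∧ x ∈ cellFace g'.1 := by
  simp only [compCells, Finset.mem_biUnion, Finset.mem_filter, Finset.mem_attach, true_and]

/-- Reachable faces have the same component cell set. -/
theorem compCells_eq_of_reachable {D : Finset (Site 2)} {g g' : {g // g ∈ D}} (h : (defectGraph D).Reachable g g') :
    compCells D g = compCells D g' := by
  ext x
  simp only [mem_compCells_iff]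
  exact ⟨fun ⟨c, hc, hx⟩ => ⟨c, h.symm.trans hc, hx⟩, fun ⟨c, hc, hx⟩ => ⟨c, h.trans hc, hx⟩⟩

/-- Distinct component cell sets are disjoint. -/
theorem disjoint_of_mem_comps {D : Finset (Site 2)} {K K' : Finset (Site 2)} (hK : K ∈ comps D) (hK' : K' ∈ comps D)
    (hne : K ≠ K') : Disjoint K K' := by
  obtain ⟨g, -, rfl⟩ := Finset.mem_image.1 hK
  obtain ⟨g', -, rfl⟩ := Finset.mem_image.1 hK'
  rw [Finset.disjoint_left]
  intro x hx hx'
  obtain ⟨a, ha, hxa⟩ := mem_compCells_iff.1 hx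
  obtain ⟨b, hb, hxb⟩ := mem_compCells_iff.1 hx'
  exact hne (compCells_eq_of_reachable (ha.trans ((reachable_of_mem_cellFace a b hxa hxb).trans hb.symm)))

/-- Component cell sets lie in `Λ` when `D ⊆ innerVertices Λ`. -/
theorem subset_of_mem_comps {D Λ : Finset (Site 2)} (hD : D ⊆ innerVertices Λ) {K : Finset (Site 2)}
    (hK : K ∈ comps D) : K ⊆ Λ := by
  obtain ⟨g, -, rfl⟩ := Finset.mem_image.1 hK
  intro x hx
  obtain ⟨a, -, hxa⟩ := mem_compCells_iff.1 hx
  exact mem_innerVertices_iff.1 (hD a.2) hxa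

/-- A cell of the block of a defect face lies in the union of the component cell sets. -/
theorem mem_biUnion_comps {D : Finset (Site 2)} {g x : Site 2} (hg : g ∈ D) (hx : x ∈ cellFace g) :
    x ∈ (comps D).biUnion id :=
  Finset.mem_biUnion.2 ⟨compCells D ⟨g, hg⟩, Finset.mem_image_of_mem _ (Finset.mem_attach _ _),
    mem_compCells_iff.2 ⟨⟨g, hg⟩, SimpleGraph.Reachable.refl _, hx⟩⟩

/-- Free cells avoid every component cell set. -/
theorem disjoint_freeCells_biUnion_comps (D Λ : Finset (Site 2)) :
    Disjoint (freeCells D Λ) ((comps D).biUnion id) := by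
  rw [Finset.disjoint_left]
  intro x hx hx'
  obtain ⟨K, hK, hxK⟩ := Finset.mem_biUnion.1 hx'
  obtain ⟨g, -, rfl⟩ := Finset.mem_image.1 hK
  obtain ⟨a, -, hxa⟩ := mem_compCells_iff.1 hxK
  exact (Finset.mem_filter.1 hx).2 a.1 a.2 hxa

/-- `Λ` is the union of the free cells and the component cell sets (for `D ⊆ innerVertices Λ`). -/
theorem freeCells_union_biUnion_comps {D Λ : Finset (Site 2)} (hD : D ⊆ innerVertices Λ) :
    freeCells D Λ ∪ (comps D).biUnion id = Λ := by
  ext x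
  constructor
  · intro hx
    rcases Finset.mem_union.1 hx with hx | hx
    · exact (Finset.mem_filter.1 hx).1
    · obtain ⟨K, hK, hxK⟩ := Finset.mem_biUnion.1 hx
      exact subset_of_mem_comps hD hK hxK
  · intro hx
    by_cases h : ∀ g ∈ D, x ∉ cellFace g
    · exact Finset.mem_union_left _ (Finset.mem_filter.2 ⟨hx, h⟩)
    · push Not at h
      obtain ⟨g, hg, hxg⟩ := h
      exact Finset.mem_union_right _ (mem_biUnion_comps hg hxg)

/-! ## §3 Local codes, admissible patterns, the chain sum -/

/-- The empty black set is a local codeword. -/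
theorem empty_mem_localCode (D K : Finset (Site 2)) : ∅ ∈ localCode D K := by
  refine Finset.mem_filter.2 ⟨Finset.empty_mem_powerset K, fun g _ _ => ?_⟩
  simpa using not_isOddFace_white g

/-- The components of an admissible pattern are proper nonempty local codewords. -/
theorem apply_mem_of_mem_patterns {D : Finset (Site 2)} {v : Finset (Site 2) → Finset (Site 2)} (hv : v ∈ patterns D)
    {K : Finset (Site 2)} (hK : K ∈ comps D) : v K ∈ ((localCode D K).erase ∅).erase K := by
  obtain ⟨f, hf, rfl⟩ := Finset.mem_image.1 hv
  simp only [dif_pos hK]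
  exact Finset.mem_pi.1 hf K hK

/-- Unpacked: `v K` is a local codeword, `v K ⊆ K`, `v K ≠ ∅`, `v K ≠ K`. -/
theorem pattern_spec {D : Finset (Site 2)} {v : Finset (Site 2) → Finset (Site 2)} (hv : v ∈ patterns D)
    {K : Finset (Site 2)} (hK : K ∈ comps D) : v K ∈ localCode D K ∧ v K ⊆ K ∧ v K ≠ ∅ ∧ v K ≠ K := by
  have h := apply_mem_of_mem_patterns hv hK
  have h1 := Finset.mem_erase.1 h
  have h2 := Finset.mem_erase.1 h1.2
  exact ⟨h2.2, Finset.mem_powerset.1 (Finset.mem_filter.1 h2.2).1, h2.1, h1.1⟩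

/-- Hence every local code met by an admissible pattern has at least the two words `∅`, `v K`. -/
theorem two_le_card_localCode {D : Finset (Site 2)} {v : Finset (Site 2) → Finset (Site 2)} (hv : v ∈ patterns D)
    {K : Finset (Site 2)} (hK : K ∈ comps D) : 2 ≤ (localCode D K).card := by
  obtain ⟨h1, -, h2, -⟩ := pattern_spec hv hK
  exact Finset.one_lt_card.2 ⟨∅, empty_mem_localCode D K, v K, h1, h2.symm⟩

/-- The three chain weights of one component sum to one: `1/V + 1/V + (V − 2)/V = 1`. -/
theorem sum_chainW_powerset {V : ℕ} (hV : V ≠ 0) {K w : Finset (Site 2)} (hwK : w ⊆ K) (hw0 : w ≠ ∅) (hwK' : w ≠ K) :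
    ∑ τ ∈ K.powerset, chainW V K w τ = 1 := by
  have hK0 : (∅ : Finset (Site 2)) ≠ K := fun h => hw0 (Finset.subset_empty.1 (h ▸ hwK))
  have hsub : ({∅, K, w} : Finset (Finset (Site 2))) ⊆ K.powerset := by
    intro x hx
    simp only [Finset.mem_insert, Finset.mem_singleton] at hx
    rw [Finset.mem_powerset]
    rcases hx with rfl | rfl | rfl
    exacts [Finset.empty_subset _, Finset.Subset.refl _, hwK]
  rw [← Finset.sum_subset hsub fun x _ hx => ?_]
  · rw [Finset.sum_insert (by simp [hK0, hw0.symm]), Finset.sum_insert (by simpa using hwK'.symm), Finset.sum_singleton]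
    have hV' : (V : ℝ) ≠ 0 := Nat.cast_ne_zero.2 hV
    simp only [chainW, if_true, if_neg hK0.symm, if_neg hw0, if_neg hwK']
    field_simp
    ring
  · simp only [Finset.mem_insert, Finset.mem_singleton, not_or] at hx
    exact chainW_eq_zero hx.1 hx.2.1 hx.2.2

end TotalMass

open TotalMass

/-! ## §4 Nonnegativity and the total mass -/

/-- The quenched weights of an admissible pattern are nonnegative. -/
theorem quenchedW_nonneg {D : Finset (Site 2)} (Λ : Finset (Site 2)) {v : Finset (Site 2) → Finset (Site 2)}
    (hv : v ∈ patterns D) (s : Finset (Site 2)) : 0 ≤ quenchedW D Λ v s := by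
  unfold quenchedW
  split_ifs
  · exact mul_nonneg (pow_nonneg (by norm_num) _)
      (Finset.prod_nonneg fun K hK => chainW_nonneg (two_le_card_localCode hv hK) _ _ _)
  · exact le_rfl

/-- Hence quenched probabilities are nonnegative … -/
theorem quenchedProb_nonneg {D : Finset (Site 2)} (Λ : Finset (Site 2)) {v : Finset (Site 2) → Finset (Site 2)}
    (hv : v ∈ patterns D) (𝒜 : Finset (Finset (Site 2))) : 0 ≤ quenchedProb D Λ v 𝒜 :=
  Finset.sum_nonneg fun s _ => quenchedW_nonneg Λ hv s

/-- … and monotone in the family. -/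
theorem quenchedProb_mono {D : Finset (Site 2)} (Λ : Finset (Site 2)) {v : Finset (Site 2) → Finset (Site 2)}
    (hv : v ∈ patterns D) {𝒜 ℬ : Finset (Finset (Site 2))} (h : 𝒜 ⊆ ℬ) : quenchedProb D Λ v 𝒜 ≤ quenchedProb D Λ v ℬ :=
  Finset.sum_le_sum_of_subset_of_nonneg h fun s _ _ => quenchedW_nonneg Λ hv s

/-- **TOTAL MASS** (registered helper stub `quenchedProb_powerset`): for `D ⊆ innerVertices Λ` and an admissible pattern
`v ∈ patterns D`, the quenched weights sum to one over `Λ.powerset` — the sum factorises along the partition of `Λ` into the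
free cells (fair product weight, `2^{|free|} · 2^{-|free|} = 1`) and the pairwise disjoint component cell sets (each chain sums
to `1/V + (V−2)/V + 1/V = 1`). -/
theorem quenchedProb_powerset : ∀ (D Λ : Finset (Site 2)), D ⊆ innerVertices Λ → ∀ v ∈ patterns D,
    quenchedProb D Λ v Λ.powerset = 1 := by
  intro D Λ hD v hv
  have hΛ : Λ.powerset = (freeCells D Λ ∪ (comps D).biUnion id).powerset := by
    rw [freeCells_union_biUnion_comps hD]
  have hdisj := disjoint_freeCells_biUnion_comps D Λ
  have hcomp : ∀ K ∈ comps D, ∑ τ ∈ K.powerset, chainW (localCode D K).card K (v K) τ = 1 := fun K hK => by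
    obtain ⟨-, h1, h2, h3⟩ := pattern_spec hv hK
    exact sum_chainW_powerset (by have := two_le_card_localCode hv hK; omega) h1 h2 h3
  calc quenchedProb D Λ v Λ.powerset
      = ∑ s ∈ Λ.powerset, ((1 : ℝ) / 2) ^ (freeCells D Λ).card *
          ∏ K ∈ comps D, chainW (localCode D K).card K (v K) (s ∩ K) :=
        Finset.sum_congr rfl fun s hs => if_pos (Finset.mem_powerset.1 hs)
    _ = ∑ a ∈ (freeCells D Λ).powerset, ∑ b ∈ ((comps D).biUnion id).powerset, ((1 : ℝ) / 2) ^ (freeCells D Λ).card *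
          ∏ K ∈ comps D, chainW (localCode D K).card K (v K) (b ∩ K) := by
        rw [hΛ, sum_powerset_union_eq hdisj]
        refine Finset.sum_congr rfl fun a ha => Finset.sum_congr rfl fun b _ => ?_
        rw [Finset.mem_powerset] at ha
        congr 1
        refine Finset.prod_congr rfl fun K hK => ?_
        have hKU : K ⊆ (comps D).biUnion id := Finset.subset_biUnion_of_mem id hK
        rw [Finset.union_inter_distrib_right, Finset.disjoint_iff_inter_eq_empty.1 ((hdisj.mono_left ha).mono_right hKU),
          Finset.empty_union]
    _ = (2 : ℝ) ^ (freeCells D Λ).card * (((1 : ℝ) / 2) ^ (freeCells D Λ).card *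
          ∏ K ∈ comps D, ∑ τ ∈ K.powerset, chainW (localCode D K).card K (v K) τ) := by
        rw [Finset.sum_const, Finset.card_powerset, nsmul_eq_mul, Nat.cast_pow, Nat.cast_two, ← Finset.mul_sum,
          sum_powerset_biUnion_prod (comps D) (fun K hK K' hK' hne => disjoint_of_mem_comps hK hK' hne)]
    _ = 1 := by
        rw [Finset.prod_eq_one hcomp, mul_one, ← mul_pow]
        norm_num

end Summit.CriticalPhenomena.CardyFormulaZ2.Cruxes.IKMixedBoxCrossing.QuenchedChainFKG

end
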